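import Mathlib
import Summits.NavierStokesRegularity.NavierStokesRegularity.Theorems.SubOnsagerCeilingKPPairExitStarvation
import Summits.NavierStokesRegularity.NavierStokesRegularity.Theorems.SubOnsagerCeilingKPBarrierCurrency
import Summits.NavierStokesRegularity.NavierStokesRegularity.Theorems.SubcriticalEnvelopeForwardSourceTailEnvelopeKPDyadicRatioTwo
import HarnessLib

/-!
# The ν-uniform shell barrier of the RE-ENTRY PAIR with strong dead-end exits, at every scale ratio (part 2 of 2)
# (helper file for the crux `SubOnsagerCeiling.ForwardTailCeilingKP`, stmt-NavierStokesRegularity-27057, `--supports`)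

Sequel of `Theorems/SubOnsagerCeilingKPPairExitStarvation.lean` (the PAIR-EXIT class: asymmetric re-entry pair `0 ⇄ 1` with forward
weights `c 0, c 1 > 0`, each live mode pumping in-shell into its own dead-end pocket, weights `P 0, P 1 ≥ 0`; closed forms and the
comparisons `x_{2,N} ≥ (P 0/c 0)x_{1,N+1}`, `x_{3,N} ≥ (P 1/c 1)x_{0,N+1}`).  Shell-summed energy starvation:

* `pairExit_flux_step` / `pairExit_flux_le` — live-pair energy balance per shell + pump work `≥ r ×` out-gate,
  `r = min (P 0²/c 0²) (P 1²/c 1²)`: `(1 + r)·G_{m+1} ≤ G_m`, `G_m ≤ E₀ q^m` for the gate fluxes `G_m = ∫₀ᵗ Λ_m (c₀x²_{0,m}x_{1,m+1} + c₁x²_{1,m}x_{0,m+1})`;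
* `pairExit_shellBarrierAt` — `ShellBarrierAt R ε₀ α`, `(1+ε₀)^{2θ} = 1 + r`, `D = 1 + r`, at EVERY scale ratio once `P a² > ε₀c a²`
  (`a = 0, 1`): the (even asymmetric) pair, so far covered at `b ≥ 1.34` (RUNG 8) or in a companion window (leafhand-1), with strong exits;
* `pairExit_ceilingAt`, `pairExit_primaryGraded` — the same in the currencies `CeilingAt` and the skeleton's `PrimaryGradedAt` body.

HONEST FRAMING: statements about Tao-type MODEL lattice ODEs (route SubOnsagerCeiling, rung TL-M2Break); one architecture class; no stub,
crux or summit is proved and nothing here bears on Navier–Stokes regularity. [cite: Tao2016AveragedNS, §4 (4.2)–(4.3), (4.8)–(4.9), (4.13)]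
-/

noncomputable section

-- the sub-problem namespace `NavierStokesRegularity.NavierStokesRegularity` is the tree's layout (D-0017)
set_option linter.dupNamespace false

namespace Summit.NavierStokesRegularity.NavierStokesRegularity.Theorems

open Set Finset MeasureTheory intervalIntegral
open scoped Topology
open Literature.Analysis.FluidPDE.TaoCascade
open Summit.NavierStokesRegularity.NavierStokesRegularity.Theorems.SubOnsagerCeiling

section PairExitFlux

variable {α : Fin 4 → Fin 4 → Fin 4 → ℤ × ℤ × ℤ → ℝ} {c P : Fin 4 → ℝ}
  (hs : IsSymmetricCoeff α) (hc : IsCancellingCoeff α)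
  (hO : ∀ (Y : Fin 4 → ℤ → ℝ → ℝ) (τ : ℝ), (∀ (j : Fin 4) (k : ℤ), 1 ≤ k → 0 ≤ Y j k τ) →
    ∀ δ : ℝ, 0 < δ → ∀ (i : Fin 4) (n : ℤ), 1 ≤ n → Y i n τ = 0 → 0 ≤ quadTerm δ α Y i n τ)
  (hD : ∀ a b i : Fin 4, a ≠ b → α a b i (0, 0, 1) = 0)
  (hF : ∀ a i : Fin 4, α a a i (0, 0, 1) = if (a = 0 ∧ i = 1) ∨ (a = 1 ∧ i = 0) then c a else 0)
  (hP : ∀ a d : Fin 4, a ≠ d → α a a d (0, 0, 0) = if (a = 0 ∧ d = 2) ∨ (a = 1 ∧ d = 3) then P a else 0)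
  (hCz : ∀ a b d : Fin 4, a ≠ b → a ≠ d → b ≠ d → α a b d (0, 0, 0) = 0)
include hs hc hO hD hF hP hCz

/-- **Starvation of the gate fluxes, one step**: `(1 + r)·G_{m+1}(t) ≤ G_m(t)`, `r = min (P 0²/c 0²) (P 1²/c 1²)`, along every honest
non-negative `ν`-viscous solution from a one-shell datum (`ν ≥ 0`, `ε₀ ≥ 0`, `c > 0`, `P ≥ 0`).
[cite: Tao2016AveragedNS, §4 (4.8)–(4.9), (4.13)] -/
theorem pairExit_flux_step {ε₀ ν s : ℝ} (hε : 0 ≤ ε₀) (hν : 0 ≤ ν) (hcpos : ∀ i, 0 < c i) (hPnn : ∀ i, 0 ≤ P i)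
    {X₀ : Fin 4 → ℝ} {X : Fin 4 → ℤ → ℝ → ℝ}
    (hdat : ∀ (i : Fin 4) (k : ℤ), X i k 0 = if k = 0 then X₀ i else 0)
    (hXc : ∀ (i : Fin 4) (k : ℤ), Continuous (X i k))
    (hode : ∀ (i : Fin 4) (k : ℤ), ∀ t ∈ Icc (0 : ℝ) s, HasDerivWithinAt (X i k)
      (quadTerm ε₀ α X i k t - ν * (1 + ε₀) ^ ((2 : ℝ) * k) * X i k t) (Icc (0 : ℝ) s) t)
    (hnn : ∀ t ∈ Icc (0 : ℝ) s, ∀ (i : Fin 4) (k : ℤ), 1 ≤ k → 0 ≤ X i k t) (m : ℕ) :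
    ∀ t ∈ Icc (0 : ℝ) s,
      (1 + min (P 0 ^ 2 / c 0 ^ 2) (P 1 ^ 2 / c 1 ^ 2)) *
          ∫ τ in (0 : ℝ)..t, (1 + ε₀) ^ ((5 : ℝ) * ((m : ℝ) + 1) / 2) *
            (c 0 * X 0 ((m : ℤ) + 1) τ ^ 2 * X 1 ((m : ℤ) + 2) τ + c 1 * X 1 ((m : ℤ) + 1) τ ^ 2 * X 0 ((m : ℤ) + 2) τ) ≤
        ∫ τ in (0 : ℝ)..t, (1 + ε₀) ^ ((5 : ℝ) * (m : ℝ) / 2) *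
          (c 0 * X 0 (m : ℤ) τ ^ 2 * X 1 ((m : ℤ) + 1) τ + c 1 * X 1 (m : ℤ) τ ^ 2 * X 0 ((m : ℤ) + 1) τ) := by
  have hb : (0 : ℝ) < 1 + ε₀ := by linarith
  set r : ℝ := min (P 0 ^ 2 / c 0 ^ 2) (P 1 ^ 2 / c 1 ^ 2) with hr
  have hr0 : 0 ≤ r := le_min (by positivity) (by positivity)
  set Λm : ℝ := (1 + ε₀) ^ ((5 : ℝ) * (m : ℝ) / 2) with hΛm
  set Λn : ℝ := (1 + ε₀) ^ ((5 : ℝ) * ((m : ℝ) + 1) / 2) with hΛn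
  set κ : ℝ := ν * (1 + ε₀) ^ ((2 : ℝ) * ((m : ℝ) + 1)) with hκ
  have hΛn0 : 0 ≤ Λn := by positivity
  have hκ0 : 0 ≤ κ := by positivity
  set x : ℝ → ℝ := fun τ => X 0 ((m : ℤ) + 1) τ with hx
  set y : ℝ → ℝ := fun τ => X 1 ((m : ℤ) + 1) τ with hy
  set xm : ℝ → ℝ := fun τ => X 0 (m : ℤ) τ with hxm
  set ym : ℝ → ℝ := fun τ => X 1 (m : ℤ) τ with hym
  set xn : ℝ → ℝ := fun τ => X 0 ((m : ℤ) + 2) τ with hxn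
  set yn : ℝ → ℝ := fun τ => X 1 ((m : ℤ) + 2) τ with hyn
  set p : ℝ → ℝ := fun τ => X 2 ((m : ℤ) + 1) τ with hp
  set q : ℝ → ℝ := fun τ => X 3 ((m : ℤ) + 1) τ with hq
  have hxc : Continuous x := hXc 0 _
  have hyc : Continuous y := hXc 1 _
  have hxmc : Continuous xm := hXc 0 _
  have hymc : Continuous ym := hXc 1 _
  have hxnc : Continuous xn := hXc 0 _
  have hync : Continuous yn := hXc 1 _
  have hpc : Continuous p := hXc 2 _
  have hqc : Continuous q := hXc 3 _
  have hidx : ((m : ℤ) + 1 - 1) = (m : ℤ) := by omega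
  have hidx2 : ((m : ℤ) + 1 + 1) = (m : ℤ) + 2 := by ring
  have he1 : ((5 : ℝ) * ((((m : ℤ) + 1 : ℤ) : ℝ) - 1) / 2) = (5 : ℝ) * (m : ℝ) / 2 := by push_cast; ring
  have he2 : ((5 : ℝ) * (((m : ℤ) + 1 : ℤ) : ℝ) / 2) = (5 : ℝ) * ((m : ℝ) + 1) / 2 := by push_cast; ring
  have he3 : ((2 : ℝ) * (((m : ℤ) + 1 : ℤ) : ℝ)) = (2 : ℝ) * ((m : ℝ) + 1) := by push_cast; ring
  -- the equations of the two live modes at shell `m+1`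
  have hxd : ∀ τ ∈ Icc (0 : ℝ) s, HasDerivWithinAt x
      (c 1 * Λm * ym τ ^ 2 - Λn * (x τ * (c 0 * yn τ + P 0 * p τ)) - κ * x τ) (Icc 0 s) τ := by
    intro τ hτ
    have h0 := hode 0 ((m : ℤ) + 1) τ hτ
    rw [pairExit_quadTerm_zero hs hc hO hD hF hP hCz] at h0
    rw [hidx, hidx2, he1, he2, he3] at h0
    refine h0.congr_deriv ?_
    simp only [hΛm, hΛn, hκ, hx, hym, hyn, hp]
  have hyd : ∀ τ ∈ Icc (0 : ℝ) s, HasDerivWithinAt y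
      (c 0 * Λm * xm τ ^ 2 - Λn * (y τ * (c 1 * xn τ + P 1 * q τ)) - κ * y τ) (Icc 0 s) τ := by
    intro τ hτ
    have h0 := hode 1 ((m : ℤ) + 1) τ hτ
    rw [pairExit_quadTerm_one hs hc hO hD hF hP hCz] at h0
    rw [hidx, hidx2, he1, he2, he3] at h0
    refine h0.congr_deriv ?_
    simp only [hΛm, hΛn, hκ, hy, hxm, hxn, hq]
  -- fluxes
  set IN : ℝ → ℝ := fun τ => Λm * (c 0 * xm τ ^ 2 * y τ + c 1 * ym τ ^ 2 * x τ) with hIN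
  set OUT : ℝ → ℝ := fun τ => Λn * (c 0 * x τ ^ 2 * yn τ + c 1 * y τ ^ 2 * xn τ) with hOUT
  set PUMP : ℝ → ℝ := fun τ => Λn * (P 0 * x τ ^ 2 * p τ + P 1 * y τ ^ 2 * q τ) with hPUMP
  set VISC : ℝ → ℝ := fun τ => κ * (x τ ^ 2 + y τ ^ 2) with hVISC
  have hINc : Continuous IN :=
    continuous_const.mul (((continuous_const.mul (hxmc.pow 2)).mul hyc).add ((continuous_const.mul (hymc.pow 2)).mul hxc))
  have hOUTc : Continuous OUT :=
    continuous_const.mul (((continuous_const.mul (hxc.pow 2)).mul hync).add ((continuous_const.mul (hyc.pow 2)).mul hxnc))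
  have hPUMPc : Continuous PUMP :=
    continuous_const.mul (((continuous_const.mul (hxc.pow 2)).mul hpc).add ((continuous_const.mul (hyc.pow 2)).mul hqc))
  have hVISCc : Continuous VISC := continuous_const.mul ((hxc.pow 2).add (hyc.pow 2))
  -- the live-pair energy balance at shell `m+1`
  set G : ℝ → ℝ := fun τ => ((1 / 2 : ℝ) * x τ ^ 2 + (1 / 2 : ℝ) * y τ ^ 2) - (∫ u in (0 : ℝ)..τ, IN u) +
    (∫ u in (0 : ℝ)..τ, OUT u) + (∫ u in (0 : ℝ)..τ, PUMP u) + ∫ u in (0 : ℝ)..τ, VISC u with hG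
  have hprim : ∀ {f : ℝ → ℝ}, Continuous f → ∀ τ : ℝ,
      HasDerivWithinAt (fun u => ∫ v in (0 : ℝ)..u, f v) (f τ) (Icc 0 s) τ := by
    intro f hf τ
    exact (intervalIntegral.integral_hasDerivAt_right (hf.intervalIntegrable _ _)
      (hf.stronglyMeasurableAtFilter _ _) hf.continuousAt).hasDerivWithinAt
  have hGd : ∀ τ ∈ Icc (0 : ℝ) s, HasDerivWithinAt G 0 (Icc 0 s) τ := by
    intro τ hτ
    have hex : HasDerivWithinAt (fun u => (1 / 2 : ℝ) * x u ^ 2)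
        ((1 / 2 : ℝ) * (((2 : ℕ) : ℝ) * x τ ^ (2 - 1) *
          (c 1 * Λm * ym τ ^ 2 - Λn * (x τ * (c 0 * yn τ + P 0 * p τ)) - κ * x τ))) (Icc 0 s) τ :=
      ((hxd τ hτ).pow 2).const_mul (1 / 2)
    have hey : HasDerivWithinAt (fun u => (1 / 2 : ℝ) * y u ^ 2)
        ((1 / 2 : ℝ) * (((2 : ℕ) : ℝ) * y τ ^ (2 - 1) *
          (c 0 * Λm * xm τ ^ 2 - Λn * (y τ * (c 1 * xn τ + P 1 * q τ)) - κ * y τ))) (Icc 0 s) τ :=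
      ((hyd τ hτ).pow 2).const_mul (1 / 2)
    have h := ((((hex.add hey).sub (hprim hINc τ)).add (hprim hOUTc τ)).add (hprim hPUMPc τ)).add (hprim hVISCc τ)
    refine h.congr_deriv ?_
    simp only [hIN, hOUT, hPUMP, hVISC]
    push_cast
    ring
  have hGc : ContinuousOn G (Icc 0 s) := fun τ hτ => (hGd τ hτ).continuousWithinAt
  have hGd' : ∀ u ∈ Ico (0 : ℝ) s, HasDerivWithinAt G 0 (Ici u) u := fun u hu =>
    (hGd u (Ico_subset_Icc_self hu)).mono_of_mem_nhdsWithin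
      (Filter.mem_of_superset (Icc_mem_nhdsGE hu.2) (Icc_subset_Icc hu.1 le_rfl))
  have hG0 : G 0 = 0 := by
    have h1 : x 0 = 0 := by simp only [hx]; rw [hdat]; simp; omega
    have h2 : y 0 = 0 := by simp only [hy]; rw [hdat]; simp; omega
    simp [hG, h1, h2]
  intro t ht
  have hGt : G t = 0 := by
    have h := constant_of_has_deriv_right_zero hGc hGd' t ht
    rw [hG0] at h
    exact h
  have hV : 0 ≤ ∫ u in (0 : ℝ)..t, VISC u :=
    intervalIntegral.integral_nonneg ht.1 fun u _ => mul_nonneg hκ0 (add_nonneg (sq_nonneg _) (sq_nonneg _))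
  have hE : 0 ≤ (1 / 2 : ℝ) * x t ^ 2 + (1 / 2 : ℝ) * y t ^ 2 := by positivity
  -- pump work ≥ r × out-gate, pointwise hence in integral
  have hdom : r * (∫ u in (0 : ℝ)..t, OUT u) ≤ ∫ u in (0 : ℝ)..t, PUMP u := by
    rw [← intervalIntegral.integral_const_mul]
    refine intervalIntegral.integral_mono_on ht.1 ((hOUTc.const_mul _).intervalIntegrable _ _)
      (hPUMPc.intervalIntegrable _ _) fun u hu => ?_
    have hus : u ∈ Icc (0 : ℝ) s := ⟨hu.1, hu.2.trans ht.2⟩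
    have hcmp0 : P 0 / c 0 * yn u ≤ p u := by
      have h' := pairExit_pocket_ge_zero hs hc hO hD hF hP hCz hε hν hcpos hPnn hdat hode hnn (N := (m : ℤ) + 1)
        (by omega) u hus
      rwa [show ((m : ℤ) + 1 + 1) = (m : ℤ) + 2 by ring] at h'
    have hcmp1 : P 1 / c 1 * xn u ≤ q u := by
      have h' := pairExit_pocket_ge_one hs hc hO hD hF hP hCz hε hν hcpos hPnn hdat hode hnn (N := (m : ℤ) + 1)
        (by omega) u hus
      rwa [show ((m : ℤ) + 1 + 1) = (m : ℤ) + 2 by ring] at h'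
    have hyn0 : 0 ≤ yn u := hnn u hus 1 _ (by omega)
    have hxn0 : 0 ≤ xn u := hnn u hus 0 _ (by omega)
    have hc0 : 0 < c 0 := hcpos 0
    have hc1 : 0 < c 1 := hcpos 1
    have hr1 : r ≤ P 0 ^ 2 / c 0 ^ 2 := min_le_left _ _
    have hr2 : r ≤ P 1 ^ 2 / c 1 ^ 2 := min_le_right _ _
    -- term by term
    have hA : r * (c 0 * x u ^ 2 * yn u) ≤ P 0 * x u ^ 2 * p u := by
      have h1 : r * (c 0 * x u ^ 2 * yn u) ≤ P 0 ^ 2 / c 0 ^ 2 * (c 0 * x u ^ 2 * yn u) :=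
        mul_le_mul_of_nonneg_right hr1 (mul_nonneg (mul_nonneg hc0.le (sq_nonneg _)) hyn0)
      have h2 : P 0 ^ 2 / c 0 ^ 2 * (c 0 * x u ^ 2 * yn u) = P 0 * x u ^ 2 * (P 0 / c 0 * yn u) := by
        field_simp
      have h3 : P 0 * x u ^ 2 * (P 0 / c 0 * yn u) ≤ P 0 * x u ^ 2 * p u :=
        mul_le_mul_of_nonneg_left hcmp0 (mul_nonneg (hPnn 0) (sq_nonneg _))
      linarith [h2.le, h2.ge]
    have hB : r * (c 1 * y u ^ 2 * xn u) ≤ P 1 * y u ^ 2 * q u := by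
      have h1 : r * (c 1 * y u ^ 2 * xn u) ≤ P 1 ^ 2 / c 1 ^ 2 * (c 1 * y u ^ 2 * xn u) :=
        mul_le_mul_of_nonneg_right hr2 (mul_nonneg (mul_nonneg hc1.le (sq_nonneg _)) hxn0)
      have h2 : P 1 ^ 2 / c 1 ^ 2 * (c 1 * y u ^ 2 * xn u) = P 1 * y u ^ 2 * (P 1 / c 1 * xn u) := by
        field_simp
      have h3 : P 1 * y u ^ 2 * (P 1 / c 1 * xn u) ≤ P 1 * y u ^ 2 * q u :=
        mul_le_mul_of_nonneg_left hcmp1 (mul_nonneg (hPnn 1) (sq_nonneg _))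
      linarith [h2.le, h2.ge]
    simp only [hOUT, hPUMP]
    have h' := mul_le_mul_of_nonneg_left (add_le_add hA hB) hΛn0
    have hid : r * (Λn * (c 0 * x u ^ 2 * yn u + c 1 * y u ^ 2 * xn u)) =
        Λn * (r * (c 0 * x u ^ 2 * yn u) + r * (c 1 * y u ^ 2 * xn u)) := by ring
    rw [hid]
    exact h'
  have hsplit : (∫ u in (0 : ℝ)..t, OUT u) + (∫ u in (0 : ℝ)..t, PUMP u) ≤ ∫ u in (0 : ℝ)..t, IN u := by
    simp only [hG] at hGt
    linarith
  have hOUTnn : 0 ≤ ∫ u in (0 : ℝ)..t, OUT u := by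
    refine intervalIntegral.integral_nonneg ht.1 fun u hu => ?_
    have hus : u ∈ Icc (0 : ℝ) s := ⟨hu.1, hu.2.trans ht.2⟩
    have h1 : 0 ≤ yn u := hnn u hus 1 _ (by omega)
    have h2 : 0 ≤ xn u := hnn u hus 0 _ (by omega)
    have hc0 : 0 < c 0 := hcpos 0
    have hc1 : 0 < c 1 := hcpos 1
    simp only [hOUT]
    exact mul_nonneg hΛn0 (add_nonneg (mul_nonneg (mul_nonneg hc0.le (sq_nonneg _)) h1)
      (mul_nonneg (mul_nonneg hc1.le (sq_nonneg _)) h2))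
  have key : (1 + r) * (∫ u in (0 : ℝ)..t, OUT u) ≤ ∫ u in (0 : ℝ)..t, IN u :=
    calc (1 + r) * (∫ u in (0 : ℝ)..t, OUT u)
        = (∫ u in (0 : ℝ)..t, OUT u) + r * (∫ u in (0 : ℝ)..t, OUT u) := by ring
      _ ≤ (∫ u in (0 : ℝ)..t, OUT u) + (∫ u in (0 : ℝ)..t, PUMP u) := by linarith [hdom]
      _ ≤ ∫ u in (0 : ℝ)..t, IN u := hsplit
  simpa only [hOUT, hIN, hx, hy, hxm, hym, hxn, hyn] using key

/-- **Starvation of the gate fluxes**: `G_m(t) ≤ E₀·q^m`, `q = (1 + r)⁻¹`, `r = min (P 0²/c 0²) (P 1²/c 1²)` (induction; base = the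
class-wide flux budget `kpProper_bondFlux_budget`). [cite: Tao2016AveragedNS, §4 (4.8)–(4.9), (4.13)] -/
theorem pairExit_flux_le {ε₀ ν s : ℝ} (hε : 0 ≤ ε₀) (hν : 0 ≤ ν) (hcpos : ∀ i, 0 < c i) (hPnn : ∀ i, 0 ≤ P i)
    {X₀ : Fin 4 → ℝ} {X : Fin 4 → ℤ → ℝ → ℝ}
    (hdat : ∀ (i : Fin 4) (k : ℤ), X i k 0 = if k = 0 then X₀ i else 0)
    (hvan : ∀ (i : Fin 4) (k : ℤ), k < 0 → ∀ t : ℝ, X i k t = 0)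
    (hXc : ∀ (i : Fin 4) (k : ℤ), Continuous (X i k))
    (hode : ∀ (i : Fin 4) (k : ℤ), ∀ t ∈ Icc (0 : ℝ) s, HasDerivWithinAt (X i k)
      (quadTerm ε₀ α X i k t - ν * (1 + ε₀) ^ ((2 : ℝ) * k) * X i k t) (Icc (0 : ℝ) s) t)
    (hnn : ∀ t ∈ Icc (0 : ℝ) s, ∀ (i : Fin 4) (k : ℤ), 1 ≤ k → 0 ≤ X i k t) :
    ∀ m : ℕ, ∀ t ∈ Icc (0 : ℝ) s,
      ∫ τ in (0 : ℝ)..t, (1 + ε₀) ^ ((5 : ℝ) * (m : ℝ) / 2) *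
          (c 0 * X 0 (m : ℤ) τ ^ 2 * X 1 ((m : ℤ) + 1) τ + c 1 * X 1 (m : ℤ) τ ^ 2 * X 0 ((m : ℤ) + 1) τ) ≤
        (∑ i, (1 / 2 : ℝ) * X₀ i ^ 2) * ((1 + min (P 0 ^ 2 / c 0 ^ 2) (P 1 ^ 2 / c 1 ^ 2))⁻¹) ^ m := by
  have hr0 : 0 ≤ min (P 0 ^ 2 / c 0 ^ 2) (P 1 ^ 2 / c 1 ^ 2) := le_min (by positivity) (by positivity)
  have hr : 0 < 1 + min (P 0 ^ 2 / c 0 ^ 2) (P 1 ^ 2 / c 1 ^ 2) := by linarith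
  intro m
  induction m with
  | zero =>
    intro t ht
    have h := kpProper_bondFlux_budget hs hc hO hD (by linarith) hν hdat hvan hXc hode 0 t ht
    simp only [pairExit_gateFlux hF] at h
    simpa using h
  | succ m ih =>
    intro t ht
    have hstep := pairExit_flux_step hs hc hO hD hF hP hCz hε hν hcpos hPnn hdat hXc hode hnn m t ht
    have hih := ih t ht
    have hcast1 : (((m + 1 : ℕ) : ℝ)) = (m : ℝ) + 1 := by push_cast; ring
    have hcast2 : (((m + 1 : ℕ) : ℤ)) = (m : ℤ) + 1 := by push_cast; ring
    have hcast3 : ((m : ℤ) + 1 + 1) = (m : ℤ) + 2 := by ring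
    rw [hcast1, hcast2, hcast3, pow_succ]
    have h2 : ∫ τ in (0 : ℝ)..t, (1 + ε₀) ^ ((5 : ℝ) * ((m : ℝ) + 1) / 2) *
        (c 0 * X 0 ((m : ℤ) + 1) τ ^ 2 * X 1 ((m : ℤ) + 2) τ + c 1 * X 1 ((m : ℤ) + 1) τ ^ 2 * X 0 ((m : ℤ) + 2) τ) ≤
        (∫ τ in (0 : ℝ)..t, (1 + ε₀) ^ ((5 : ℝ) * (m : ℝ) / 2) *
          (c 0 * X 0 (m : ℤ) τ ^ 2 * X 1 ((m : ℤ) + 1) τ + c 1 * X 1 (m : ℤ) τ ^ 2 * X 0 ((m : ℤ) + 1) τ)) *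
          (1 + min (P 0 ^ 2 / c 0 ^ 2) (P 1 ^ 2 / c 1 ^ 2))⁻¹ := by
      rw [le_mul_inv_iff₀ hr, mul_comm]
      exact hstep
    calc _ ≤ _ := h2
      _ ≤ (∑ i, (1 / 2 : ℝ) * X₀ i ^ 2) * ((1 + min (P 0 ^ 2 / c 0 ^ 2) (P 1 ^ 2 / c 1 ^ 2))⁻¹) ^ m *
            (1 + min (P 0 ^ 2 / c 0 ^ 2) (P 1 ^ 2 / c 1 ^ 2))⁻¹ :=
          mul_le_mul_of_nonneg_right hih (inv_nonneg.2 hr.le)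
      _ = _ := by ring

end PairExitFlux

/-! ## The barrier -/

/-- **ENERGY STARVATION BARRIER FOR THE RE-ENTRY PAIR WITH STRONG EXITS.**  For every KP network proper `α ∈ E₂(R)` of the pair-exit
class (`c 0, c 1 > 0`, `P ≥ 0`) with `P 0² > ε₀·c 0²` and `P 1² > ε₀·c 1²`, at EVERY scale ratio `1 + ε₀ > 1`: `ShellBarrierAt R ε₀ α`
with `(1+ε₀)^{2θ} = 1 + r`, `r = min (P 0²/c 0²) (P 1²/c 1²)`, `D = 1 + r`. MODEL lattice statement; a corner of the registered stubs,
not the stubs. [cite: Tao2016AveragedNS, §4 (4.13)] -/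
theorem pairExit_shellBarrierAt {α : Fin 4 → Fin 4 → Fin 4 → ℤ × ℤ × ℤ → ℝ} {c P : Fin 4 → ℝ} {ε₀ : ℝ}
    (hε : 0 < ε₀) (hcpos : ∀ i, 0 < c i) (hPnn : ∀ i, 0 ≤ P i)
    (hgap0 : ε₀ * c 0 ^ 2 < P 0 ^ 2) (hgap1 : ε₀ * c 1 ^ 2 < P 1 ^ 2)
    (hD : ∀ a b i : Fin 4, a ≠ b → α a b i (0, 0, 1) = 0)
    (hF : ∀ a i : Fin 4, α a a i (0, 0, 1) = if (a = 0 ∧ i = 1) ∨ (a = 1 ∧ i = 0) then c a else 0)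
    (hP : ∀ a d : Fin 4, a ≠ d → α a a d (0, 0, 0) = if (a = 0 ∧ d = 2) ∨ (a = 1 ∧ d = 3) then P a else 0)
    (hCz : ∀ a b d : Fin 4, a ≠ b → a ≠ d → b ≠ d → α a b d (0, 0, 0) = 0) (R : ℝ) :
    ShellBarrierAt R ε₀ α := by
  intro hT hO
  have hs : IsSymmetricCoeff α := hT.1
  have hc : IsCancellingCoeff α := hT.2.1
  set r : ℝ := min (P 0 ^ 2 / c 0 ^ 2) (P 1 ^ 2 / c 1 ^ 2) with hr
  have hr0' : 0 ≤ r := le_min (by positivity) (by positivity)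
  have hr0 : 0 < 1 + r := by linarith
  have hb1 : (1 : ℝ) < 1 + ε₀ := by linarith
  have hb0 : (0 : ℝ) < 1 + ε₀ := by linarith
  have hrb : 1 + ε₀ < 1 + r := by
    have h0 : ε₀ < P 0 ^ 2 / c 0 ^ 2 := by rw [lt_div_iff₀ (pow_pos (hcpos 0) 2)]; exact hgap0
    have h1 : ε₀ < P 1 ^ 2 / c 1 ^ 2 := by rw [lt_div_iff₀ (pow_pos (hcpos 1) 2)]; exact hgap1
    have : ε₀ < r := lt_min h0 h1
    linarith
  set θ : ℝ := Real.logb (1 + ε₀) (1 + r) / 2 with hθ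
  have hθhalf : 1 / 2 < θ := by
    have : 1 < Real.logb (1 + ε₀) (1 + r) := by
      rw [Real.lt_logb_iff_rpow_lt hb1 hr0, Real.rpow_one]
      exact hrb
    simp only [hθ]
    linarith
  have hpow : (1 + ε₀) ^ (2 * θ) = 1 + r := by
    have : 2 * θ = Real.logb (1 + ε₀) (1 + r) := by simp only [hθ]; ring
    rw [this, Real.rpow_logb hb0 hb1.ne' hr0]
  refine ⟨θ, hθhalf, 1 + r, hr0.le, ?_⟩
  intro ν hν X₀ s _hs X hX0 hXneg _hM hXc hXd hXpos t ht i k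
  set E₀ : ℝ := ∑ j : Fin 4, (1 / 2 : ℝ) * X₀ j ^ 2 with hE₀
  have hE₀0 : 0 ≤ E₀ := Finset.sum_nonneg fun j _ => by positivity
  have hq1 : (1 + r) * (1 + r)⁻¹ = 1 := mul_inv_cancel₀ hr0.ne'
  have hshell : ∑ j : Fin 4, (1 / 2 : ℝ) * X j (k : ℤ) t ^ 2 ≤ E₀ * (1 + r) * ((1 + r)⁻¹) ^ k := by
    cases k with
    | zero =>
      have h := kpProper_lowEnergy_le hs hc hO hD hb0 hν.le hX0 hXneg hXc hXd hXpos 0 t ht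
      rw [Finset.range_one, Finset.sum_singleton] at h
      have h1 : E₀ ≤ E₀ * (1 + r) * ((1 + r)⁻¹) ^ 0 := by
        rw [pow_zero, mul_one]
        nlinarith
      exact h.trans h1
    | succ m =>
      have hband := kpProper_bandEnergy_le_gateFlux hs hc hO hD hb0 hν.le hX0 hXneg hXc hXd hXpos
        (m := m) (N := m + 1) (by omega) t ht
      rw [Finset.Icc_self, Finset.sum_singleton] at hband
      simp only [pairExit_gateFlux hF] at hband
      have hflux := pairExit_flux_le hs hc hO hD hF hP hCz hε.le hν.le hcpos hPnn hX0 hXneg hXc hXd hXpos m t ht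
      have heq : E₀ * ((1 + r)⁻¹) ^ m = E₀ * (1 + r) * ((1 + r)⁻¹) ^ (m + 1) := by
        rw [pow_succ, show E₀ * (1 + r) * (((1 + r)⁻¹) ^ m * (1 + r)⁻¹) =
          E₀ * ((1 + r)⁻¹) ^ m * ((1 + r) * (1 + r)⁻¹) by ring, hq1, mul_one]
      calc ∑ j : Fin 4, (1 / 2 : ℝ) * X j ((m + 1 : ℕ) : ℤ) t ^ 2 ≤ _ := hband
        _ ≤ E₀ * ((1 + r)⁻¹) ^ m := hflux
        _ = _ := heq
  have hsingle : (1 / 2 : ℝ) * X i (k : ℤ) t ^ 2 ≤ ∑ j : Fin 4, (1 / 2 : ℝ) * X j (k : ℤ) t ^ 2 :=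
    Finset.single_le_sum (f := fun j => (1 / 2 : ℝ) * X j (k : ℤ) t ^ 2) (fun j _ => by positivity)
      (Finset.mem_univ i)
  have hweight : (1 + ε₀) ^ (2 * θ * (k : ℝ)) = (1 + r) ^ k := by
    rw [Real.rpow_mul hb0.le, hpow, Real.rpow_natCast]
  rw [hweight]
  calc (1 + r) ^ k * ((1 / 2 : ℝ) * X i (k : ℤ) t ^ 2) ≤ (1 + r) ^ k * (E₀ * (1 + r) * ((1 + r)⁻¹) ^ k) :=
        mul_le_mul_of_nonneg_left (hsingle.trans hshell) (pow_nonneg hr0.le k)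
    _ = (1 + r) * E₀ := by
        rw [show (1 + r) ^ k * (E₀ * (1 + r) * ((1 + r)⁻¹) ^ k) =
          (1 + r) * E₀ * ((1 + r) * (1 + r)⁻¹) ^ k by rw [mul_pow]; ring, hq1, one_pow, mul_one]

/-- **Tail ceiling** for the pair-exit class with strong exits (`CeilingAt R ε₀ α`). MODEL lattice statement.
[cite: Tao2016AveragedNS, §4 (4.13)] -/
theorem pairExit_ceilingAt {α : Fin 4 → Fin 4 → Fin 4 → ℤ × ℤ × ℤ → ℝ} {c P : Fin 4 → ℝ} {ε₀ : ℝ}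
    (hε : 0 < ε₀) (hcpos : ∀ i, 0 < c i) (hPnn : ∀ i, 0 ≤ P i)
    (hgap0 : ε₀ * c 0 ^ 2 < P 0 ^ 2) (hgap1 : ε₀ * c 1 ^ 2 < P 1 ^ 2)
    (hD : ∀ a b i : Fin 4, a ≠ b → α a b i (0, 0, 1) = 0)
    (hF : ∀ a i : Fin 4, α a a i (0, 0, 1) = if (a = 0 ∧ i = 1) ∨ (a = 1 ∧ i = 0) then c a else 0)
    (hP : ∀ a d : Fin 4, a ≠ d → α a a d (0, 0, 0) = if (a = 0 ∧ d = 2) ∨ (a = 1 ∧ d = 3) then P a else 0)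
    (hCz : ∀ a b d : Fin 4, a ≠ b → a ≠ d → b ≠ d → α a b d (0, 0, 0) = 0) (R : ℝ) :
    CeilingAt R ε₀ α :=
  subOnsagerCeiling_ceilingAt_of_shellBarrierAt hε (pairExit_shellBarrierAt hε hcpos hPnn hgap0 hgap1 hD hF hP hCz R)

/-- **The registered stubs' currency**: the body of the skeleton's `PrimaryGradedAt R ε₀ α` (verbatim) for every pair-exit network
with strong exits, at every scale ratio. MODEL lattice statement; a corner of BOTH registered stubs, not the stubs.
[cite: Tao2016AveragedNS, §4 (4.13)] -/
theorem pairExit_primaryGraded {α : Fin 4 → Fin 4 → Fin 4 → ℤ × ℤ × ℤ → ℝ} {c P : Fin 4 → ℝ} {ε₀ : ℝ}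
    (hε : 0 < ε₀) (hcpos : ∀ i, 0 < c i) (hPnn : ∀ i, 0 ≤ P i)
    (hgap0 : ε₀ * c 0 ^ 2 < P 0 ^ 2) (hgap1 : ε₀ * c 1 ^ 2 < P 1 ^ 2)
    (hD : ∀ a b i : Fin 4, a ≠ b → α a b i (0, 0, 1) = 0)
    (hF : ∀ a i : Fin 4, α a a i (0, 0, 1) = if (a = 0 ∧ i = 1) ∨ (a = 1 ∧ i = 0) then c a else 0)
    (hP : ∀ a d : Fin 4, a ≠ d → α a a d (0, 0, 0) = if (a = 0 ∧ d = 2) ∨ (a = 1 ∧ d = 3) then P a else 0)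
    (hCz : ∀ a b d : Fin 4, a ≠ b → a ≠ d → b ≠ d → α a b d (0, 0, 0) = 0) (R : ℝ) :
    Literature.Analysis.FluidPDE.TaoCascade.InTableClass R α →
      (∀ (Y : Fin 4 → ℤ → ℝ → ℝ) (τ : ℝ), (∀ (j : Fin 4) (k : ℤ), 1 ≤ k → 0 ≤ Y j k τ) → ∀ δ : ℝ, 0 < δ →
        ∀ (i : Fin 4) (n : ℤ), 1 ≤ n → Y i n τ = 0 → 0 ≤ Literature.Analysis.FluidPDE.TaoCascade.quadTerm δ α Y i n τ) →
      (∀ a b i : Fin 4, a ≠ b → α a b i (0, 0, 1) = 0) →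
      ∃ (lev : Fin 4 → ℕ) (L : ℕ), (∀ a, lev a ≤ L) ∧
        (∀ a, lev a ≠ 0 → (∃ e, α a a e (0, 0, 1) ≠ 0) →
          (∀ j, α j j a (0, 0, 1) ≠ 0 → lev j < lev a ∧ (lev j = 0 ∨ ∃ e', α j j e' (0, 0, 1) ≠ 0)) ∧
          (∀ i₁ i₂, i₁ ≠ a → i₂ ≠ a → α i₁ i₂ a (0, 0, 0) ≠ 0 →
            (lev i₁ < lev a ∧ (lev i₁ = 0 ∨ ∃ e', α i₁ i₁ e' (0, 0, 1) ≠ 0)) ∧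
            (lev i₂ < lev a ∧ (lev i₂ = 0 ∨ ∃ e', α i₂ i₂ e' (0, 0, 1) ≠ 0))) ∧
          (∃ e, α a a e (0, 0, 1) ≠ 0 ∧
            (∀ j, α e e j (0, 0, 1) ≠ 0 → lev j < lev a ∧ (lev j = 0 ∨ ∃ e', α j j e' (0, 0, 1) ≠ 0)) ∧
            (∀ j, j ≠ e → α e e j (0, 0, 0) ≠ 0 →
              lev j < lev a ∧ (lev j = 0 ∨ ∃ e', α j j e' (0, 0, 1) ≠ 0)))) ∧
        ∃ θ : ℝ, 1 / 2 < θ ∧ θ ≤ 1 ∧ ∃ D : ℝ, 0 ≤ D ∧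
          ∀ ν : ℝ, 0 < ν → ∀ (X₀ : Fin 4 → ℝ) (s : ℝ), 0 < s → ∀ X : Fin 4 → ℤ → ℝ → ℝ,
          (∀ (i : Fin 4) (k : ℤ), X i k 0 = if k = 0 then X₀ i else 0) →
          (∀ (i : Fin 4) (k : ℤ), k < 0 → ∀ t : ℝ, X i k t = 0) →
          (∃ M : ℝ, ∀ (t : ℝ) (i : Fin 4) (k : ℤ), (1 + (1 + ε₀) ^ ((10 : ℝ) * k)) * |X i k t| ≤ M) →
          (∀ (i : Fin 4) (k : ℤ), Continuous (X i k)) →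
          (∀ (i : Fin 4) (k : ℤ), ∀ t ∈ Set.Icc (0 : ℝ) s, HasDerivWithinAt (X i k)
            (Literature.Analysis.FluidPDE.TaoCascade.quadTerm ε₀ α X i k t - ν * (1 + ε₀) ^ ((2 : ℝ) * k) * X i k t)
            (Set.Icc (0 : ℝ) s) t) →
          (∀ t ∈ Set.Icc (0 : ℝ) s, ∀ (i : Fin 4) (k : ℤ), 1 ≤ k → 0 ≤ X i k t) →
          ∀ t ∈ Set.Icc (0 : ℝ) s, ∀ i, lev i = 0 → ∀ k : ℕ,
            (1 + ε₀) ^ (2 * θ * (k : ℝ)) * ((1 / 2 : ℝ) * X i (k : ℤ) t ^ 2) ≤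
              D * (∑ j : Fin 4, (1 / 2 : ℝ) * X₀ j ^ 2) :=
  kpPrimaryGraded_of_shellBarrierAt hε (pairExit_shellBarrierAt hε hcpos hPnn hgap0 hgap1 hD hF hP hCz R)

end Summit.NavierStokesRegularity.NavierStokesRegularity.Theorems

end
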